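import Mathlib.Analysis.SpecialFunctions.Log.Deriv
import Mathlib.Analysis.SpecialFunctions.ExpDeriv
import Summits.Ventures.HSemireg.WedgeHankelRecurrenceGaussLobattoUnique

/-!
# Venture HSemireg — **MARKOV'S THEOREM FOR A ONE-PARAMETER FAMILY OF WEIGHTS (the classical differentiable form)**: if the density `g(τ, w)` is positive and differentiable in the parameter and
# its logarithmic derivative `∂_τ log g(τ, w)` is a non-decreasing function of the node `w` for every `τ ∈ [τ₀, τ₁]`, then the ratio `g(τ₁, ·)∕g(τ₀, ·)` is non-decreasing along the nodes and
# EVERY Gauss node is a non-decreasing function of `τ`: `x_k(τ₀) ≤ x_k(τ₁)` (strictly increasing when the log-derivative is strictly increasing in `w`); corollaries: the exponential tilt `e^{τw}`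
# and the power `w^τ` (`w > 0`) push all Gauss nodes to the right as `τ` grows

HONEST FRAMING. Part of the Lean index of the computation cell `pub-hsemireg` (seat p10 gen 45, Sunday typer «UNIFORM-IN-n»).  Finite sums, real polynomials and one-variable calculus (`Real.log`,
`Real.exp`, `monotoneOn_of_deriv_nonneg`) only; no variety, no cohomology theory, no sheaf, no Ext group and no semiregularity map is constructed here; nothing here says that HC / HC_CM / HC_AV
holds; no Literature fact (unproved `Prop`) is declared or used.  Custodian versions as in `WedgeHankelSiegelIdeal` (1/3).
SOURCES (cited).  A. Markov, *Sur les racines de certaines équations (second note)*, Math. Ann. 27 (1886) 177–182; G. Szegő, *Orthogonal Polynomials*, Thm 6.12.1 (the nodes increase with `τ`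
when `∂_τ log w(x, τ)` is an increasing function of `x`) and §6.21 (Jacobi ∕ Laguerre examples); M. E. H. Ismail, *Classical and Quantum Orthogonal Polynomials* (2005) Thm 7.1.1; M. E. H. Ismail,
M. E. Muldoon, Trans. AMS 323 (1991) 65–78, §2 (the two-measure reformulation used by N320); T. J. Stieltjes, *Sur les racines de l'équation X_n = 0*, Acta Math. 9 (1886) 385–400 and
Szegő Thm 6.21.1 (zeros of Jacobi polynomials: increasing in `β`, decreasing in `α`).
PROOF TYPED HERE.  For two nodes `w_l < w_{l'}` the function `φ(σ) = log g(σ, w_{l'}) − log g(σ, w_l)` has derivative `≥ 0` on `[τ₀, τ₁]`, hence is non-decreasing (`monotoneOn_of_deriv_nonneg`),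
and `φ(τ₀) ≤ φ(τ₁)` is the ratio inequality `g(τ₁,w_l)∕g(τ₀,w_l) ≤ g(τ₁,w_{l'})∕g(τ₀,w_{l'})`; then N320 `markov_monotone` ∕ `markov_strictMono` for the base measure `g(τ₀,·)ν` and the density
`g(τ₁,·)∕g(τ₀,·)`.  The corollaries compute the log-derivatives `w` and `log w`.
DEDUP DISCLOSURE (`rg -n 'markov_param|logDeriv|tilt' Summits/Ventures/HSemireg`, 2026-09-03): N320 ∕ N321 ∕ N345 are the two-measure forms (monotone density ratio assumed); the differentiable
one-parameter form and the two corollaries are new (N321 `stieltjes_factor_nodes_lt` is the integer-exponent case of the power corollary).  The 10 names below: 0 hits tree-wide.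

WHAT IS IN THE TREE.  N320 `markov_monotone`, `markov_strictMono`; Mathlib `monotoneOn_of_deriv_nonneg`, `strictMonoOn_of_deriv_pos`, `HasDerivAt.log`, `Real.hasDerivAt_exp`, `Real.log_le_log_iff`.
THIS FILE (namespace `Summit.Ventures.HSemireg.Wedge.HankelOuter` continued; CHAINED on N351 (import only); 0 definitions):
* §1117 **`density_ratio_mono_of_logDeriv`** (log-derivative non-decreasing along `w` on `[τ₀, τ₁]` ⇒ ratio `g(τ₁)∕g(τ₀)` non-decreasing along `w`), `density_ratio_strictMono_of_logDeriv`
  (strict form), **`markov_parameter_monotone`** (`x_k(τ₀) ≤ x_k(τ₁)`), **`markov_parameter_strictMono`** (`<`, with `N ≥ t + 2`), **`gauss_nodes_exp_tilt_mono`** (density `e^{τ w}`),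
  **`gauss_nodes_power_mono`** (density `w^τ = e^{τ log w}`, `w > 0`), `density_ratio_anti_of_logDeriv` ∕ **`markov_parameter_antitone`** (the decreasing case, via the reversed node order),
  **`gauss_nodes_jacobi_beta_mono`** ∕ **`gauss_nodes_jacobi_alpha_anti`** (Stieltjes: Jacobi-type weights `(1+w)^β`, `(1−w)^α` on nodes in `(−1,1)`: nodes increase with `β`, decrease with `α`).
CAVEATS.  Discrete positive measures, `(t+1)`-point Gauss rules given by their moments; derivative hypotheses on the closed parameter interval.  Nothing Ext-side.  New names only.
-/

open Module Polynomial
open scoped Matrix Polynomial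

namespace Summit.Ventures.HSemireg.Wedge.HankelOuter

/-! ## §1117. Markov's theorem for a differentiable one-parameter weight -/

/-- **A non-decreasing logarithmic `τ`-derivative along the nodes makes the density ratio non-decreasing along the nodes**: `g(σ, l) > 0` with `∂_σ g = D` on `[τ₀, τ₁]` and
`D(σ,l)∕g(σ,l) ≤ D(σ,l')∕g(σ,l')` whenever `w_l < w_{l'}` ⇒ `g(τ₁,l)∕g(τ₀,l) ≤ g(τ₁,l')∕g(τ₀,l')` for `w_l < w_{l'}` (`τ₀ ≤ τ₁`). [Szegő Thm 6.12.1 (proof); this file, §1117] -/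
theorem density_ratio_mono_of_logDeriv {N : ℕ} {w : Fin N → ℝ} {g D : ℝ → Fin N → ℝ} {τ₀ τ₁ : ℝ} (hτ : τ₀ ≤ τ₁)
    (hg : ∀ σ ∈ Set.Icc τ₀ τ₁, ∀ l, 0 < g σ l) (hD : ∀ σ ∈ Set.Icc τ₀ τ₁, ∀ l, HasDerivAt (fun σ => g σ l) (D σ l) σ)
    (hlog : ∀ σ ∈ Set.Icc τ₀ τ₁, ∀ l l', w l < w l' → D σ l / g σ l ≤ D σ l' / g σ l') {l l' : Fin N} (hll' : w l < w l') :
    g τ₁ l / g τ₀ l ≤ g τ₁ l' / g τ₀ l' := by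
  have hτ₀ : τ₀ ∈ Set.Icc τ₀ τ₁ := ⟨le_rfl, hτ⟩
  have hτ₁ : τ₁ ∈ Set.Icc τ₀ τ₁ := ⟨hτ, le_rfl⟩
  -- `φ(σ) = log g(σ,l') − log g(σ,l)` is non-decreasing on the interval
  have hφ : ∀ σ ∈ Set.Icc τ₀ τ₁, HasDerivAt (fun σ => Real.log (g σ l') - Real.log (g σ l)) (D σ l' / g σ l' - D σ l / g σ l) σ := fun σ hσ =>
    ((hD σ hσ l').log (hg σ hσ l').ne').sub ((hD σ hσ l).log (hg σ hσ l).ne')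
  have hmono : MonotoneOn (fun σ => Real.log (g σ l') - Real.log (g σ l)) (Set.Icc τ₀ τ₁) := by
    refine monotoneOn_of_deriv_nonneg (convex_Icc τ₀ τ₁) (fun σ hσ => (hφ σ hσ).continuousAt.continuousWithinAt)
      (fun σ hσ => (hφ σ (interior_subset hσ)).differentiableAt.differentiableWithinAt) fun σ hσ => ?_
    rw [(hφ σ (interior_subset hσ)).deriv]
    exact sub_nonneg.2 (hlog σ (interior_subset hσ) l l' hll')
  have h := hmono hτ₀ hτ₁ hτ
  dsimp only at h
  have h1 : Real.log (g τ₀ l' * g τ₁ l) ≤ Real.log (g τ₁ l' * g τ₀ l) := by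
    rw [Real.log_mul (hg _ hτ₀ l').ne' (hg _ hτ₁ l).ne', Real.log_mul (hg _ hτ₁ l').ne' (hg _ hτ₀ l).ne']; linarith
  rw [Real.log_le_log_iff (mul_pos (hg _ hτ₀ l') (hg _ hτ₁ l)) (mul_pos (hg _ hτ₁ l') (hg _ hτ₀ l))] at h1
  rw [div_le_div_iff₀ (hg _ hτ₀ l) (hg _ hτ₀ l')]
  linarith

/-- **Strict form**: a log-derivative STRICTLY increasing along the nodes on `[τ₀, τ₁]` (`τ₀ < τ₁`) makes the ratio strictly increasing along the nodes. [Szegő Thm 6.12.1; this file, §1117] -/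
theorem density_ratio_strictMono_of_logDeriv {N : ℕ} {w : Fin N → ℝ} {g D : ℝ → Fin N → ℝ} {τ₀ τ₁ : ℝ} (hτ : τ₀ < τ₁)
    (hg : ∀ σ ∈ Set.Icc τ₀ τ₁, ∀ l, 0 < g σ l) (hD : ∀ σ ∈ Set.Icc τ₀ τ₁, ∀ l, HasDerivAt (fun σ => g σ l) (D σ l) σ)
    (hlog : ∀ σ ∈ Set.Icc τ₀ τ₁, ∀ l l', w l < w l' → D σ l / g σ l < D σ l' / g σ l') {l l' : Fin N} (hll' : w l < w l') :
    g τ₁ l / g τ₀ l < g τ₁ l' / g τ₀ l' := by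
  have hτ₀ : τ₀ ∈ Set.Icc τ₀ τ₁ := ⟨le_rfl, hτ.le⟩
  have hτ₁ : τ₁ ∈ Set.Icc τ₀ τ₁ := ⟨hτ.le, le_rfl⟩
  have hφ : ∀ σ ∈ Set.Icc τ₀ τ₁, HasDerivAt (fun σ => Real.log (g σ l') - Real.log (g σ l)) (D σ l' / g σ l' - D σ l / g σ l) σ := fun σ hσ =>
    ((hD σ hσ l').log (hg σ hσ l').ne').sub ((hD σ hσ l).log (hg σ hσ l).ne')
  have hmono : StrictMonoOn (fun σ => Real.log (g σ l') - Real.log (g σ l)) (Set.Icc τ₀ τ₁) := by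
    refine strictMonoOn_of_deriv_pos (convex_Icc τ₀ τ₁) (fun σ hσ => (hφ σ hσ).continuousAt.continuousWithinAt) fun σ hσ => ?_
    rw [(hφ σ (interior_subset hσ)).deriv]
    exact sub_pos.2 (hlog σ (interior_subset hσ) l l' hll')
  have h := hmono hτ₀ hτ₁ hτ
  dsimp only at h
  have h1 : Real.log (g τ₀ l' * g τ₁ l) < Real.log (g τ₁ l' * g τ₀ l) := by
    rw [Real.log_mul (hg _ hτ₀ l').ne' (hg _ hτ₁ l).ne', Real.log_mul (hg _ hτ₁ l').ne' (hg _ hτ₀ l).ne']; linarith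
  rw [Real.log_lt_log_iff (mul_pos (hg _ hτ₀ l') (hg _ hτ₁ l)) (mul_pos (hg _ hτ₁ l') (hg _ hτ₀ l))] at h1
  rw [div_lt_div_iff₀ (hg _ hτ₀ l) (hg _ hτ₀ l')]
  linarith

/-- **MARKOV'S THEOREM, ONE-PARAMETER FORM: the Gauss nodes are non-decreasing in `τ`.**  `ν > 0` on distinct nodes `w` (`N ≥ t + 1`); densities `g(τ, ·) > 0` differentiable in `τ` on `[τ₀, τ₁]`
with `∂_τ log g` non-decreasing along `w`; `(μ, x)` and `(μ', y)` the `(t+1)`-point Gauss rules of `g(τ₀,·)ν` and `g(τ₁,·)ν` ⇒ `x_k ≤ y_k` for every `k`. [Markov 1886; Szegő Thm 6.12.1; Ismail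
Thm 7.1.1; this file, §1117] -/
theorem markov_parameter_monotone {t N : ℕ} {ν w : Fin N → ℝ} (hν : ∀ l, 0 < ν l) (hw : Function.Injective w) (hN : t + 1 ≤ N)
    {g D : ℝ → Fin N → ℝ} {τ₀ τ₁ : ℝ} (hτ : τ₀ ≤ τ₁)
    (hg : ∀ σ ∈ Set.Icc τ₀ τ₁, ∀ l, 0 < g σ l) (hD : ∀ σ ∈ Set.Icc τ₀ τ₁, ∀ l, HasDerivAt (fun σ => g σ l) (D σ l) σ)
    (hlog : ∀ σ ∈ Set.Icc τ₀ τ₁, ∀ l l', w l < w l' → D σ l / g σ l ≤ D σ l' / g σ l')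
    {μ x μ' y : Fin (t + 1) → ℝ} (hx : StrictMono x) (hy : StrictMono y)
    (hmom : ∀ p, p ≤ 2 * t + 1 → ∑ j, μ j * x j ^ p = ∑ l, (g τ₀ l * ν l) * w l ^ p)
    (hmom' : ∀ p, p ≤ 2 * t + 1 → ∑ j, μ' j * y j ^ p = ∑ l, (g τ₁ l * ν l) * w l ^ p) (k : Fin (t + 1)) :
    x k ≤ y k := by
  have hτ₀ : τ₀ ∈ Set.Icc τ₀ τ₁ := ⟨le_rfl, hτ⟩
  have hτ₁ : τ₁ ∈ Set.Icc τ₀ τ₁ := ⟨hτ, le_rfl⟩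
  refine markov_monotone (ν := fun l => g τ₀ l * ν l) (g := fun l => g τ₁ l / g τ₀ l) (μ' := μ') (fun l => mul_pos (hg _ hτ₀ l) (hν l)) hw hN
    (fun l => div_pos (hg _ hτ₁ l) (hg _ hτ₀ l)) (fun l l' h => density_ratio_mono_of_logDeriv hτ hg hD hlog h) hx hy hmom (fun p hp => ?_) k
  rw [hmom' p hp]
  exact Finset.sum_congr rfl fun l _ => by rw [div_mul_eq_mul_div, mul_assoc, mul_div_assoc, mul_div_cancel_left₀ _ (hg _ hτ₀ l).ne']; ring

/-- **Strict one-parameter form: `x_k < y_k`** when `τ₀ < τ₁`, `N ≥ t + 2` and `∂_τ log g` is strictly increasing along `w`. [Szegő Thm 6.12.1; this file, §1117] -/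
theorem markov_parameter_strictMono {t N : ℕ} {ν w : Fin N → ℝ} (hν : ∀ l, 0 < ν l) (hw : Function.Injective w) (hN : t + 2 ≤ N)
    {g D : ℝ → Fin N → ℝ} {τ₀ τ₁ : ℝ} (hτ : τ₀ < τ₁)
    (hg : ∀ σ ∈ Set.Icc τ₀ τ₁, ∀ l, 0 < g σ l) (hD : ∀ σ ∈ Set.Icc τ₀ τ₁, ∀ l, HasDerivAt (fun σ => g σ l) (D σ l) σ)
    (hlog : ∀ σ ∈ Set.Icc τ₀ τ₁, ∀ l l', w l < w l' → D σ l / g σ l < D σ l' / g σ l')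
    {μ x μ' y : Fin (t + 1) → ℝ} (hx : StrictMono x) (hy : StrictMono y)
    (hmom : ∀ p, p ≤ 2 * t + 1 → ∑ j, μ j * x j ^ p = ∑ l, (g τ₀ l * ν l) * w l ^ p)
    (hmom' : ∀ p, p ≤ 2 * t + 1 → ∑ j, μ' j * y j ^ p = ∑ l, (g τ₁ l * ν l) * w l ^ p) (k : Fin (t + 1)) :
    x k < y k := by
  have hτ₀ : τ₀ ∈ Set.Icc τ₀ τ₁ := ⟨le_rfl, hτ.le⟩
  have hτ₁ : τ₁ ∈ Set.Icc τ₀ τ₁ := ⟨hτ.le, le_rfl⟩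
  refine markov_strictMono (ν := fun l => g τ₀ l * ν l) (g := fun l => g τ₁ l / g τ₀ l) (μ' := μ') (fun l => mul_pos (hg _ hτ₀ l) (hν l)) hw hN
    (fun l => div_pos (hg _ hτ₁ l) (hg _ hτ₀ l)) (fun l l' h => density_ratio_strictMono_of_logDeriv hτ hg hD hlog h) hx hy hmom (fun p hp => ?_) k
  rw [hmom' p hp]
  exact Finset.sum_congr rfl fun l _ => by rw [div_mul_eq_mul_div, mul_assoc, mul_div_assoc, mul_div_cancel_left₀ _ (hg _ hτ₀ l).ne']; ring

/-- **COROLLARY (exponential tilting): the Gauss nodes of `e^{τ w}·ν` are non-decreasing in `τ`** (`∂_τ log e^{τw} = w`). [Szegő §6.21 type; this file, §1117] -/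
theorem gauss_nodes_exp_tilt_mono {t N : ℕ} {ν w : Fin N → ℝ} (hν : ∀ l, 0 < ν l) (hw : Function.Injective w) (hN : t + 1 ≤ N) {τ₀ τ₁ : ℝ} (hτ : τ₀ ≤ τ₁)
    {μ x μ' y : Fin (t + 1) → ℝ} (hx : StrictMono x) (hy : StrictMono y)
    (hmom : ∀ p, p ≤ 2 * t + 1 → ∑ j, μ j * x j ^ p = ∑ l, (Real.exp (τ₀ * w l) * ν l) * w l ^ p)
    (hmom' : ∀ p, p ≤ 2 * t + 1 → ∑ j, μ' j * y j ^ p = ∑ l, (Real.exp (τ₁ * w l) * ν l) * w l ^ p) (k : Fin (t + 1)) :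
    x k ≤ y k := by
  have hD : ∀ σ : ℝ, ∀ l, HasDerivAt (fun σ => Real.exp (σ * w l)) (Real.exp (σ * w l) * w l) σ := fun σ l => by
    have h := ((hasDerivAt_id σ).mul_const (w l)).exp
    simpa using h
  refine markov_parameter_monotone (g := fun σ l => Real.exp (σ * w l)) (D := fun σ l => Real.exp (σ * w l) * w l) hν hw hN hτ (fun σ _ l => Real.exp_pos _)
    (fun σ _ l => hD σ l) (fun σ _ l l' h => ?_) hx hy hmom hmom' k
  rw [mul_div_cancel_left₀ _ (Real.exp_pos _).ne', mul_div_cancel_left₀ _ (Real.exp_pos _).ne']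
  exact h.le

/-- **COROLLARY (real powers): for positive nodes the Gauss nodes of `w^τ·ν = e^{τ log w}·ν` are non-decreasing in `τ`** (`∂_τ log w^τ = log w` is increasing in `w`) — the real-exponent form of
N321 `stieltjes_factor_nodes_lt`. [Szegő §6.21; this file, §1117] -/
theorem gauss_nodes_power_mono {t N : ℕ} {ν w : Fin N → ℝ} (hν : ∀ l, 0 < ν l) (hw : Function.Injective w) (hN : t + 1 ≤ N) (hw0 : ∀ l, 0 < w l) {τ₀ τ₁ : ℝ} (hτ : τ₀ ≤ τ₁)
    {μ x μ' y : Fin (t + 1) → ℝ} (hx : StrictMono x) (hy : StrictMono y)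
    (hmom : ∀ p, p ≤ 2 * t + 1 → ∑ j, μ j * x j ^ p = ∑ l, (Real.exp (τ₀ * Real.log (w l)) * ν l) * w l ^ p)
    (hmom' : ∀ p, p ≤ 2 * t + 1 → ∑ j, μ' j * y j ^ p = ∑ l, (Real.exp (τ₁ * Real.log (w l)) * ν l) * w l ^ p) (k : Fin (t + 1)) :
    x k ≤ y k := by
  have hD : ∀ σ : ℝ, ∀ l, HasDerivAt (fun σ => Real.exp (σ * Real.log (w l))) (Real.exp (σ * Real.log (w l)) * Real.log (w l)) σ := fun σ l => by
    have h := ((hasDerivAt_id σ).mul_const (Real.log (w l))).exp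
    simpa using h
  refine markov_parameter_monotone (g := fun σ l => Real.exp (σ * Real.log (w l))) (D := fun σ l => Real.exp (σ * Real.log (w l)) * Real.log (w l)) hν hw hN hτ
    (fun σ _ l => Real.exp_pos _) (fun σ _ l => hD σ l) (fun σ _ l l' h => ?_) hx hy hmom hmom' k
  rw [mul_div_cancel_left₀ _ (Real.exp_pos _).ne', mul_div_cancel_left₀ _ (Real.exp_pos _).ne']
  exact (Real.log_lt_log (hw0 l) h).le

/-- **Antitone form of the ratio lemma**: a log-derivative NON-INCREASING along the nodes on `[τ₀, τ₁]` makes the ratio `g(τ₁)∕g(τ₀)` non-increasing along the nodes. [Szegő Thm 6.12.1; this file,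
§1117] -/
theorem density_ratio_anti_of_logDeriv {N : ℕ} {w : Fin N → ℝ} {g D : ℝ → Fin N → ℝ} {τ₀ τ₁ : ℝ} (hτ : τ₀ ≤ τ₁)
    (hg : ∀ σ ∈ Set.Icc τ₀ τ₁, ∀ l, 0 < g σ l) (hD : ∀ σ ∈ Set.Icc τ₀ τ₁, ∀ l, HasDerivAt (fun σ => g σ l) (D σ l) σ)
    (hlog : ∀ σ ∈ Set.Icc τ₀ τ₁, ∀ l l', w l < w l' → D σ l' / g σ l' ≤ D σ l / g σ l) {l l' : Fin N} (hll' : w l < w l') :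
    g τ₁ l' / g τ₀ l' ≤ g τ₁ l / g τ₀ l :=
  -- apply the monotone form to the reversed node order `−w`
  density_ratio_mono_of_logDeriv (w := fun l => -w l) hτ hg hD (fun σ hσ l l' h => hlog σ hσ l' l (by linarith)) (neg_lt_neg hll')

/-- **MARKOV'S THEOREM, ONE-PARAMETER FORM, DECREASING CASE: `∂_τ log g` non-increasing along the nodes ⇒ every Gauss node is non-increasing in `τ`: `y_k ≤ x_k`.** [Markov 1886; Szegő
Thm 6.12.1; this file, §1117] -/
theorem markov_parameter_antitone {t N : ℕ} {ν w : Fin N → ℝ} (hν : ∀ l, 0 < ν l) (hw : Function.Injective w) (hN : t + 1 ≤ N)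
    {g D : ℝ → Fin N → ℝ} {τ₀ τ₁ : ℝ} (hτ : τ₀ ≤ τ₁)
    (hg : ∀ σ ∈ Set.Icc τ₀ τ₁, ∀ l, 0 < g σ l) (hD : ∀ σ ∈ Set.Icc τ₀ τ₁, ∀ l, HasDerivAt (fun σ => g σ l) (D σ l) σ)
    (hlog : ∀ σ ∈ Set.Icc τ₀ τ₁, ∀ l l', w l < w l' → D σ l' / g σ l' ≤ D σ l / g σ l)
    {μ x μ' y : Fin (t + 1) → ℝ} (hx : StrictMono x) (hy : StrictMono y)
    (hmom : ∀ p, p ≤ 2 * t + 1 → ∑ j, μ j * x j ^ p = ∑ l, (g τ₀ l * ν l) * w l ^ p)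
    (hmom' : ∀ p, p ≤ 2 * t + 1 → ∑ j, μ' j * y j ^ p = ∑ l, (g τ₁ l * ν l) * w l ^ p) (k : Fin (t + 1)) :
    y k ≤ x k := by
  have hτ₀ : τ₀ ∈ Set.Icc τ₀ τ₁ := ⟨le_rfl, hτ⟩
  have hτ₁ : τ₁ ∈ Set.Icc τ₀ τ₁ := ⟨hτ, le_rfl⟩
  refine markov_antitone (ν := fun l => g τ₀ l * ν l) (g := fun l => g τ₁ l / g τ₀ l) (μ' := μ') (fun l => mul_pos (hg _ hτ₀ l) (hν l)) hw hN
    (fun l => div_pos (hg _ hτ₁ l) (hg _ hτ₀ l)) (fun l l' h => density_ratio_anti_of_logDeriv hτ hg hD hlog h) hx hy hmom (fun p hp => ?_) k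
  rw [hmom' p hp]
  exact Finset.sum_congr rfl fun l _ => by rw [div_mul_eq_mul_div, mul_assoc, mul_div_assoc, mul_div_cancel_left₀ _ (hg _ hτ₀ l).ne']; ring

/-- **STIELTJES' THEOREM FOR JACOBI-TYPE WEIGHTS, `β`-PART: on nodes in `(−1, 1)` the Gauss nodes of `(1 + w)^β·ν = e^{β log(1+w)}·ν` are non-decreasing in `β`** (`∂_β log = log(1 + w)`
increases with `w`). [Stieltjes 1886; Szegő Thm 6.21.1; this file, §1117] -/
theorem gauss_nodes_jacobi_beta_mono {t N : ℕ} {ν w : Fin N → ℝ} (hν : ∀ l, 0 < ν l) (hw : Function.Injective w) (hN : t + 1 ≤ N) (hw1 : ∀ l, -1 < w l) {β₀ β₁ : ℝ} (hβ : β₀ ≤ β₁)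
    {μ x μ' y : Fin (t + 1) → ℝ} (hx : StrictMono x) (hy : StrictMono y)
    (hmom : ∀ p, p ≤ 2 * t + 1 → ∑ j, μ j * x j ^ p = ∑ l, (Real.exp (β₀ * Real.log (1 + w l)) * ν l) * w l ^ p)
    (hmom' : ∀ p, p ≤ 2 * t + 1 → ∑ j, μ' j * y j ^ p = ∑ l, (Real.exp (β₁ * Real.log (1 + w l)) * ν l) * w l ^ p) (k : Fin (t + 1)) :
    x k ≤ y k := by
  have hD : ∀ σ : ℝ, ∀ l, HasDerivAt (fun σ => Real.exp (σ * Real.log (1 + w l))) (Real.exp (σ * Real.log (1 + w l)) * Real.log (1 + w l)) σ := fun σ l => by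
    have h := ((hasDerivAt_id σ).mul_const (Real.log (1 + w l))).exp
    simpa using h
  refine markov_parameter_monotone (g := fun σ l => Real.exp (σ * Real.log (1 + w l))) (D := fun σ l => Real.exp (σ * Real.log (1 + w l)) * Real.log (1 + w l)) hν hw hN hβ
    (fun σ _ l => Real.exp_pos _) (fun σ _ l => hD σ l) (fun σ _ l l' h => ?_) hx hy hmom hmom' k
  rw [mul_div_cancel_left₀ _ (Real.exp_pos _).ne', mul_div_cancel_left₀ _ (Real.exp_pos _).ne']
  exact (Real.log_lt_log (by linarith [hw1 l]) (by linarith)).le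

/-- **STIELTJES' THEOREM FOR JACOBI-TYPE WEIGHTS, `α`-PART: on nodes in `(−1, 1)` the Gauss nodes of `(1 − w)^α·ν = e^{α log(1−w)}·ν` are non-increasing in `α`** (`∂_α log = log(1 − w)`
decreases with `w`). [Stieltjes 1886; Szegő Thm 6.21.1; this file, §1117] -/
theorem gauss_nodes_jacobi_alpha_anti {t N : ℕ} {ν w : Fin N → ℝ} (hν : ∀ l, 0 < ν l) (hw : Function.Injective w) (hN : t + 1 ≤ N) (hw1 : ∀ l, w l < 1) {α₀ α₁ : ℝ} (hα : α₀ ≤ α₁)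
    {μ x μ' y : Fin (t + 1) → ℝ} (hx : StrictMono x) (hy : StrictMono y)
    (hmom : ∀ p, p ≤ 2 * t + 1 → ∑ j, μ j * x j ^ p = ∑ l, (Real.exp (α₀ * Real.log (1 - w l)) * ν l) * w l ^ p)
    (hmom' : ∀ p, p ≤ 2 * t + 1 → ∑ j, μ' j * y j ^ p = ∑ l, (Real.exp (α₁ * Real.log (1 - w l)) * ν l) * w l ^ p) (k : Fin (t + 1)) :
    y k ≤ x k := by
  have hD : ∀ σ : ℝ, ∀ l, HasDerivAt (fun σ => Real.exp (σ * Real.log (1 - w l))) (Real.exp (σ * Real.log (1 - w l)) * Real.log (1 - w l)) σ := fun σ l => by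
    have h := ((hasDerivAt_id σ).mul_const (Real.log (1 - w l))).exp
    simpa using h
  refine markov_parameter_antitone (g := fun σ l => Real.exp (σ * Real.log (1 - w l))) (D := fun σ l => Real.exp (σ * Real.log (1 - w l)) * Real.log (1 - w l)) hν hw hN hα
    (fun σ _ l => Real.exp_pos _) (fun σ _ l => hD σ l) (fun σ _ l l' h => ?_) hx hy hmom hmom' k
  rw [mul_div_cancel_left₀ _ (Real.exp_pos _).ne', mul_div_cancel_left₀ _ (Real.exp_pos _).ne']
  exact (Real.log_lt_log (by linarith [hw1 l']) (by linarith)).le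

end Summit.Ventures.HSemireg.Wedge.HankelOuter
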